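import Mathlib
import Literature.NumberTheory.Automorphic.FuchsianGroupCusps
import Literature.NumberTheory.Automorphic.FundamentalDomainUnfolding
import Literature.NumberTheory.Automorphic.MaassFormZeroMode

/-!
# Cuspidal zones of a Fuchsian group: separation, area, and finitely many cusps for finite covolume
(Iwaniec, *Spectral Methods of Automorphic Forms*, GSM 53, §2.2: (2.1)–(2.5) and Prop. 2.3–2.5;
§2.6 (2.30)–(2.31); PDF pp. 28–31, 37)

Second brick (after `FuchsianGroupCusps.lean`: Shimizu's lemma, the stabiliser of a cusp, scaling
matrices (2.1), Lemma 2.10) of the theory of cusps of a GENERAL discrete `Γ ≤ SL₂(ℝ)` (inside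
`GL₂(ℝ)`, `-1 ∈ Γ`, `IsDiscreteSubgroup Γ` of `HyperbolicLaplaceSpectrum.lean`), towards the general
finite-volume cases of the named facts `Iwaniec2002_thm_7_4` (`PretraceEstimate.lean`) and
`Iwaniec2002_eq_12_5` (`AutomorphicKernel.lean`). That file lists among its "next bricks" the
finiteness of the number of inequivalent cusps for finite covolume (Props. 2.3–2.5, stated without
proof in the book); this file proves it, together with the separation of the cuspidal zones
`σ_𝔞 P(Y)` ((2.2)–(2.5)) on which it rests. The book's "finite volume group" is a Fuchsian group of
the first kind, which "has a finite number of generators and a fundamental domain of finite volume"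
(Prop. 2.3) and a fundamental polygon with finitely many inequivalent cuspidal vertices (Prop. 2.4);
the named facts instead quantify over discrete `Γ` with a measurable fundamental domain `F` of finite
hyperbolic area (`IsHypFundamentalDomain`). The bridge proved here: **the number of inequivalent
cusps is at most `|F|`** — the argument behind (2.31) ("the polygon contains the semi-strip
`P(c_𝔞⁻¹)` of volume `c_𝔞`, so `c_𝔞 < |F|`") run for all cusps at once, WITHOUT fundamental
polygons. Everything here is proved; nothing is vendored.

1. (§1) **Separation of horoballs by Shimizu's lemma.** For a scaling matrix `σ` of the cusp `𝔞`
   (`σ ∞ = 𝔞`, periods of `σ⁻¹Γσ` equal to `ℤ`, as produced by `Fuchsian.exists_scaling`): the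
   lower-left entry of `σ⁻¹γσ`, `γ ∈ Γ`, vanishes iff `γ 𝔞 = 𝔞` and otherwise is `≥ 1` in absolute
   value (`one_le_abs_conj_c`), whence `Im(σ⁻¹γσ w) · Im w ≤ 1` (`im_conj_smul_mul_im_le_one`) and
   the horoball `σ {Im > Y}`, `Y ≥ 1`, meets its `γ`-translate only for `γ ∈ Γ_𝔞`
   (`smul_cusp_eq_of_horoball_meet`); for scaling matrices `σ`, `τ` of DISTINCT cusps the entry
   `c(σ⁻¹τ)` has `|c| ≥ 1` (`one_le_abs_c_of_ne`: `σ⁻¹Γσ ∋ (1 1; 0 1)` contains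
   `(σ⁻¹τ)(1 1; 0 1)(σ⁻¹τ)⁻¹` with lower-left entry `-c²`) and the horoballs `σ {Im > 1}`,
   `τ {Im > 1}` are disjoint (`horoball_disjoint`) — "for `Y` sufficiently large the cuspidal zones
   are disjoint", with the explicit `Y = 1` of Shimizu's normalisation `c_𝔞 ≥ 1`. Scaling data are
   stable under `σ ↦ γσ`, `𝔞 ↦ γ𝔞` (`scaling_smul`).
2. (§2) The semi-strip `cuspStrip Y = P(Y) = {0 ≤ x < 1, y > Y}` ((2.2)), of hyperbolic area `1/Y`
   (`volume_cuspStrip`), and the cuspidal zones `σ P(Y)` ((2.3)), of the same area.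
3. (§3) **The cuspidal zones of inequivalent cusps inject into `Γ\ℍ`**
   (`eq_or_eq_neg_of_smul_mem_zones`): for `Y ≥ 1` at most the two matrices `±γ ∈ Γ` move a given
   `w` into `⋃_i σ_i P(Y)` (separation, precise invariance, `σ⁻¹Γ_𝔞σ = {±(1 n; 0 1)}` from
   `Fuchsian.mem_and_apply_10_eq_zero_iff`, and `(1 n; 0 1)P(Y) ∩ P(Y) = ∅` for `n ≠ 0`).
4. (§4) **`#{inequivalent cusps} ≤ |F|`** (`card_le_volume_of_inequivalent_cusps`): unfolding
   (`setLIntegral_tsum_smul_eq`, `FundamentalDomainUnfolding.lean`) gives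
   `2 |⋃_i σ_i P(1)| = ∫_F #{γ ∈ Γ : γw ∈ ⋃_i σ_i P(1)} dμ(w) ≤ 2|F|`, and the zones are disjoint of
   area `1` each.
5. (§5) For finite covolume: the cusp orbits (Mathlib's `CuspOrbits Γ`) form a finite type
   (`finite_cuspOrbits`), and there is a **complete finite system of inequivalent cusps with scaling
   matrices** `(𝔞_i, σ_i)_{i < h}`, `h ≤ |F|` (`exists_cuspSystem`) — the standing data "`𝔞` runs
   over inequivalent cusps, `σ_𝔞` a scaling matrix" of Chapters 3–8 (Prop. 2.4 with (2.1)).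

Not here: the compactness of the central part `F(Y)` ((2.5), Siegel's theorem proper), Lemma 2.11 /
Corollary 2.12, the invariant height.

## References
* [Iwaniec2002] H. Iwaniec, *Spectral Methods of Automorphic Forms*, 2nd ed., GSM 53, AMS 2002,
  §2.2 (2.1)–(2.5) & Prop. 2.3–2.5, PDF pp. 28–31; §2.6 (2.30)–(2.31), PDF p. 37 (locators in the
  pagination of `FuchsianGroupCusps.lean` / `HyperbolicLaplaceSpectrum.lean`).
* Shimizu's lemma: H. Shimizu, *On discontinuous groups operating on the product of the upper half
  planes*, Ann. of Math. 77 (1963), 33–71, Lemma 4 [Shimizu1963].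

Mathlib: `MeasureTheory.measure_smul` (`SMulInvariantMeasure (GL (Fin 2) ℝ) ℍ volume`),
`Set.mem_smul_set`, `MeasureTheory.setLIntegral_one`, `lintegral_indicator_one`, `lintegral_prod_mul`,
`Complex.volume_preserving_equiv_real_prod`, `integral_Ioi_rpow_of_lt`,
`UpperHalfPlane.c_mul_im_sq_le_normSq_denom`, `UpperHalfPlane.im_smul_eq_div_normSq`, `CuspOrbits`,
`MulAction.orbitRel.Quotient`, `Infinite.exists_subset_card_eq`,
`AddSubgroup.zmultiples_eq_zmultiples_iff`. Literature: `Fuchsian.exists_scaling`,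
`Fuchsian.one_le_abs_mul_of_mem` (Shimizu), `Fuchsian.conj_translSL_apply`,
`Fuchsian.mem_and_apply_10_eq_zero_iff`, `Fuchsian.mem_conj_inv_iff`, `IsDiscreteSubgroup.conj`,
`Fuchsian.conj_le_range`, `Fuchsian.isCusp_infty_of_mem`, `Fuchsian.strictPeriods_eq_zmultiples`
(`FuchsianGroupCusps.lean`); `setLIntegral_tsum_smul_eq`, `IsDiscreteSubgroup.countable`
(`FundamentalDomainUnfolding.lean`); `setLIntegral_upperHalfPlane` (`MaassFormZeroMode.lean`). No
cusp count or cuspidal zones for Fuchsian groups existed (`lean search 'cuspidal zone|inequivalent cusps|CuspOrbits.*Finite|cuspStrip'`: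
only Mathlib's finiteness of `CuspOrbits` for *arithmetic* subgroups).
-/

noncomputable section

namespace Literature.NumberTheory.Automorphic

namespace Fuchsian

open Matrix UpperHalfPlane _root_.MeasureTheory _root_.Set
open scoped _root_.MatrixGroups _root_.Pointwise _root_.ENNReal _root_.NNReal

variable {Γ : Subgroup (GL (Fin 2) ℝ)} {F : Set ℍ}

/-! ## 1. Separation of horoballs -/

section Separation

variable {𝔞 𝔟 : OnePoint ℝ} {σ τ : SL(2, ℝ)}

/-- Periods `ℤ` contain `1`: the unit translation lies in `σ⁻¹Γσ`. [cite: Iwaniec2002, §2.2 (2.1), PDF p. 30] -/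
theorem upperRightHom_one_mem_of_periods
    (hper : (ConjAct.toConjAct (Matrix.SpecialLinearGroup.toGL σ : GL (Fin 2) ℝ)⁻¹ • Γ).strictPeriods =
      AddSubgroup.zmultiples 1) :
    Matrix.GeneralLinearGroup.upperRightHom (1 : ℝ) ∈
      ConjAct.toConjAct (Matrix.SpecialLinearGroup.toGL σ : GL (Fin 2) ℝ)⁻¹ • Γ := by
  rw [← Subgroup.mem_strictPeriods_iff, hper]
  exact AddSubgroup.mem_zmultiples 1

/-- With periods `ℤ`, the width of `∞` in `σ⁻¹Γσ` is exactly `1`. [cite: Iwaniec2002, §2.2 (2.1), PDF p. 30] -/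
theorem strictWidthInfty_eq_one_of_periods (hd : IsDiscreteSubgroup Γ)
    (hper : (ConjAct.toConjAct (Matrix.SpecialLinearGroup.toGL σ : GL (Fin 2) ℝ)⁻¹ • Γ).strictPeriods =
      AddSubgroup.zmultiples 1) :
    (ConjAct.toConjAct (Matrix.SpecialLinearGroup.toGL σ : GL (Fin 2) ℝ)⁻¹ • Γ).strictWidthInfty = 1 := by
  set Γ' := ConjAct.toConjAct (Matrix.SpecialLinearGroup.toGL σ : GL (Fin 2) ℝ)⁻¹ • Γ
  have hd' : IsDiscreteSubgroup Γ' := hd.conj _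
  have h1 := strictPeriods_eq_zmultiples hd'
  rw [hper, AddSubgroup.zmultiples_eq_zmultiples_iff (not_isOfFinAddOrder_of_isAddTorsionFree one_ne_zero)]
    at h1
  have h0 : 0 ≤ Γ'.strictWidthInfty := Subgroup.strictWidthInfty_nonneg Γ'
  rcases h1 with h1 | h1
  · exact h1.symm
  · linarith

/-- `σ⁻¹ δ σ ∈ σ⁻¹ Γ σ` for `δ ∈ Γ`. [folklore] -/
theorem conj_mem_conj_inv {δ : GL (Fin 2) ℝ} (hδ : δ ∈ Γ) (G : GL (Fin 2) ℝ) :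
    G⁻¹ * δ * G ∈ ConjAct.toConjAct G⁻¹ • Γ := by
  rw [mem_conj_inv_iff]
  simpa [mul_assoc] using hδ

/-- The lower-left entry of `σ⁻¹γσ` vanishes exactly when `γ` fixes the cusp `σ∞`. [folklore] -/
theorem conj_c_eq_zero_iff
    (hσ : (Matrix.SpecialLinearGroup.toGL σ : GL (Fin 2) ℝ) • (OnePoint.infty : OnePoint ℝ) = 𝔞)
    (γ : GL (Fin 2) ℝ) :
    (((Matrix.SpecialLinearGroup.toGL σ : GL (Fin 2) ℝ)⁻¹ * γ * Matrix.SpecialLinearGroup.toGL σ :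
        GL (Fin 2) ℝ) 1 0 : ℝ) = 0 ↔ γ • 𝔞 = 𝔞 := by
  rw [← OnePoint.smul_infty_eq_self_iff, mul_smul, mul_smul, ← hσ, inv_smul_eq_iff]

/-- **`c_𝔞 ≥ 1`** ((2.30) in Shimizu's normalisation): for `γ ∈ Γ ∖ Γ_𝔞` the lower-left entry of
`σ⁻¹γσ` is at least `1` in absolute value. [cite: Iwaniec2002, §2.6 (2.30), PDF p. 37] -/
theorem one_le_abs_conj_c
    (hΓ : Γ ≤ (Matrix.SpecialLinearGroup.toGL : SL(2, ℝ) →* GL (Fin 2) ℝ).range)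
    (hd : IsDiscreteSubgroup Γ)
    (hσ : (Matrix.SpecialLinearGroup.toGL σ : GL (Fin 2) ℝ) • (OnePoint.infty : OnePoint ℝ) = 𝔞)
    (hper : (ConjAct.toConjAct (Matrix.SpecialLinearGroup.toGL σ : GL (Fin 2) ℝ)⁻¹ • Γ).strictPeriods =
      AddSubgroup.zmultiples 1)
    {γ : GL (Fin 2) ℝ} (hγ : γ ∈ Γ) (hne : γ • 𝔞 ≠ 𝔞) :
    1 ≤ |(((Matrix.SpecialLinearGroup.toGL σ : GL (Fin 2) ℝ)⁻¹ * γ *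
        Matrix.SpecialLinearGroup.toGL σ : GL (Fin 2) ℝ) 1 0 : ℝ)| := by
  have hΓ' := conj_le_range hΓ σ⁻¹
  rw [map_inv] at hΓ'
  have hc : (((Matrix.SpecialLinearGroup.toGL σ : GL (Fin 2) ℝ)⁻¹ * γ *
      Matrix.SpecialLinearGroup.toGL σ : GL (Fin 2) ℝ) 1 0 : ℝ) ≠ 0 :=
    fun h0 => hne ((conj_c_eq_zero_iff hσ γ).mp h0)
  have h := one_le_abs_mul_of_mem hΓ' (hd.conj _) one_pos (upperRightHom_one_mem_of_periods hper)
    (conj_mem_conj_inv hγ _) hc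
  rwa [mul_one] at h

/-- If `g ∈ SL₂(ℝ)` has `|c| ≥ 1` then `Im(g w) · Im w ≤ 1` (`Im(g w) = Im w/|cw + d|² ≤ 1/(c² Im w)`;
the inequality behind the disjointness of cuspidal zones and Lemma 2.10).
[cite: Iwaniec2002, proof of Lemma 2.10, PDF p. 39] -/
theorem im_smul_mul_im_le_one {g : GL (Fin 2) ℝ}
    (hg : g ∈ (Matrix.SpecialLinearGroup.toGL : SL(2, ℝ) →* GL (Fin 2) ℝ).range)
    (hc : 1 ≤ |(g 1 0 : ℝ)|) (w : ℍ) : (g • w).im * w.im ≤ 1 := by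
  obtain ⟨g, rfl⟩ := hg
  have hdet : |((Matrix.SpecialLinearGroup.toGL g : GL (Fin 2) ℝ).det.val : ℝ)| = 1 := by simp
  rw [UpperHalfPlane.im_smul_eq_div_normSq, hdet, one_mul]
  have h1 := UpperHalfPlane.c_mul_im_sq_le_normSq_denom (Matrix.SpecialLinearGroup.toGL g) w
  have hpos : 0 < Complex.normSq (denom (Matrix.SpecialLinearGroup.toGL g : GL (Fin 2) ℝ) w) :=
    UpperHalfPlane.normSq_denom_pos _ w.im_ne_zero
  rw [div_mul_eq_mul_div, div_le_one hpos]
  have hw := w.im_pos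
  have hc2 : 1 ≤ ((Matrix.SpecialLinearGroup.toGL g : GL (Fin 2) ℝ) 1 0 : ℝ) ^ 2 := by
    have := sq_abs ((Matrix.SpecialLinearGroup.toGL g : GL (Fin 2) ℝ) 1 0 : ℝ)
    nlinarith [abs_nonneg ((Matrix.SpecialLinearGroup.toGL g : GL (Fin 2) ℝ) 1 0 : ℝ)]
  calc w.im * w.im ≤ ((Matrix.SpecialLinearGroup.toGL g : GL (Fin 2) ℝ) 1 0 : ℝ) ^ 2 * (w.im * w.im) :=
        le_mul_of_one_le_left (by positivity) hc2
    _ = (((Matrix.SpecialLinearGroup.toGL g : GL (Fin 2) ℝ) 1 0 : ℝ) * w.im) ^ 2 := by ring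
    _ ≤ _ := h1

/-- For `γ ∈ Γ ∖ Γ_𝔞`: `Im(σ⁻¹γσ w) · Im w ≤ 1`. [cite: Iwaniec2002, proof of Lemma 2.10, PDF p. 39] -/
theorem im_conj_smul_mul_im_le_one
    (hΓ : Γ ≤ (Matrix.SpecialLinearGroup.toGL : SL(2, ℝ) →* GL (Fin 2) ℝ).range)
    (hd : IsDiscreteSubgroup Γ)
    (hσ : (Matrix.SpecialLinearGroup.toGL σ : GL (Fin 2) ℝ) • (OnePoint.infty : OnePoint ℝ) = 𝔞)
    (hper : (ConjAct.toConjAct (Matrix.SpecialLinearGroup.toGL σ : GL (Fin 2) ℝ)⁻¹ • Γ).strictPeriods =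
      AddSubgroup.zmultiples 1)
    {γ : GL (Fin 2) ℝ} (hγ : γ ∈ Γ) (hne : γ • 𝔞 ≠ 𝔞) (w : ℍ) :
    ((((Matrix.SpecialLinearGroup.toGL σ : GL (Fin 2) ℝ)⁻¹ * γ * Matrix.SpecialLinearGroup.toGL σ :
        GL (Fin 2) ℝ)) • w).im * w.im ≤ 1 := by
  have hΓ' := conj_le_range hΓ σ⁻¹
  rw [map_inv] at hΓ'
  exact im_smul_mul_im_le_one (hΓ' (conj_mem_conj_inv hγ _)) (one_le_abs_conj_c hΓ hd hσ hper hγ hne) w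

/-- **Precise invariance of the horoballs** `σ {Im w > Y}`, `Y ≥ 1`: if `γ ∈ Γ` maps a point of
the horoball into the horoball then `γ ∈ Γ_𝔞` (the cuspidal zone `σ_𝔞 P(Y)` of (2.3) meets its
`Γ`-translates only through `Γ_𝔞`). [cite: Iwaniec2002, §2.2 (2.3)–(2.5), PDF pp. 30–31] -/
theorem smul_cusp_eq_of_horoball_meet
    (hΓ : Γ ≤ (Matrix.SpecialLinearGroup.toGL : SL(2, ℝ) →* GL (Fin 2) ℝ).range)
    (hd : IsDiscreteSubgroup Γ)
    (hσ : (Matrix.SpecialLinearGroup.toGL σ : GL (Fin 2) ℝ) • (OnePoint.infty : OnePoint ℝ) = 𝔞)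
    (hper : (ConjAct.toConjAct (Matrix.SpecialLinearGroup.toGL σ : GL (Fin 2) ℝ)⁻¹ • Γ).strictPeriods =
      AddSubgroup.zmultiples 1)
    {γ : GL (Fin 2) ℝ} (hγ : γ ∈ Γ) {Y : ℝ} (hY : 1 ≤ Y) {w w' : ℍ} (hw : Y < w.im) (hw' : Y < w'.im)
    (heq : γ • ((Matrix.SpecialLinearGroup.toGL σ : GL (Fin 2) ℝ) • w') =
      (Matrix.SpecialLinearGroup.toGL σ : GL (Fin 2) ℝ) • w) :
    γ • 𝔞 = 𝔞 := by
  by_contra hne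
  have key := im_conj_smul_mul_im_le_one hΓ hd hσ hper hγ hne w'
  have e : (((Matrix.SpecialLinearGroup.toGL σ : GL (Fin 2) ℝ)⁻¹ * γ *
      Matrix.SpecialLinearGroup.toGL σ : GL (Fin 2) ℝ)) • w' = w := by
    rw [mul_smul, mul_smul, heq, inv_smul_smul]
  rw [e] at key
  have hw0 := w.im_pos
  nlinarith

/-- **Two distinct cusps**: if `σ`, `τ` are scaling matrices of cusps `𝔞 ≠ 𝔟` of `Γ` then the
lower-left entry of `σ⁻¹τ` has absolute value `≥ 1` (the group `σ⁻¹Γσ ∋ (1 1; 0 1)` contains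
`(σ⁻¹τ)(1 1; 0 1)(σ⁻¹τ)⁻¹`, whose lower-left entry is `-c²`; the number `c(𝔞, 𝔟)` of §2.6).
[cite: Iwaniec2002, §2.6 (2.30), PDF p. 37] -/
theorem one_le_abs_c_of_ne
    (hΓ : Γ ≤ (Matrix.SpecialLinearGroup.toGL : SL(2, ℝ) →* GL (Fin 2) ℝ).range)
    (hd : IsDiscreteSubgroup Γ)
    (hσ : (Matrix.SpecialLinearGroup.toGL σ : GL (Fin 2) ℝ) • (OnePoint.infty : OnePoint ℝ) = 𝔞)
    (hper : (ConjAct.toConjAct (Matrix.SpecialLinearGroup.toGL σ : GL (Fin 2) ℝ)⁻¹ • Γ).strictPeriods =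
      AddSubgroup.zmultiples 1)
    (hτ : (Matrix.SpecialLinearGroup.toGL τ : GL (Fin 2) ℝ) • (OnePoint.infty : OnePoint ℝ) = 𝔟)
    (hperτ : (ConjAct.toConjAct (Matrix.SpecialLinearGroup.toGL τ : GL (Fin 2) ℝ)⁻¹ • Γ).strictPeriods =
      AddSubgroup.zmultiples 1)
    (hab : 𝔞 ≠ 𝔟) : 1 ≤ |(σ⁻¹ * τ) 1 0| := by
  have hΓ' := conj_le_range hΓ σ⁻¹
  rw [map_inv] at hΓ'
  -- `τ T τ⁻¹ ∈ Γ`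
  have hτT : (Matrix.SpecialLinearGroup.toGL (τ * translSL 1 * τ⁻¹) : GL (Fin 2) ℝ) ∈ Γ := by
    have h := upperRightHom_one_mem_of_periods hperτ
    rw [mem_conj_inv_iff, ← toGL_translSL, ← map_mul, ← map_inv, ← map_mul] at h
    exact h
  -- hence `(σ⁻¹τ) T (σ⁻¹τ)⁻¹ ∈ σ⁻¹Γσ`
  have hmem : (Matrix.SpecialLinearGroup.toGL ((σ⁻¹ * τ) * translSL 1 * (σ⁻¹ * τ)⁻¹) : GL (Fin 2) ℝ) ∈
      ConjAct.toConjAct (Matrix.SpecialLinearGroup.toGL σ : GL (Fin 2) ℝ)⁻¹ • Γ := by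
    rw [mem_conj_inv_iff, ← map_mul, ← map_inv, ← map_mul]
    have e : σ * (σ⁻¹ * τ * translSL 1 * (σ⁻¹ * τ)⁻¹) * σ⁻¹ = τ * translSL 1 * τ⁻¹ := by group
    rw [e]
    exact hτT
  have e : ((Matrix.SpecialLinearGroup.toGL (σ⁻¹ * τ * translSL 1 * (σ⁻¹ * τ)⁻¹) : GL (Fin 2) ℝ) 1 0 : ℝ) =
      -((σ⁻¹ * τ) 1 0) ^ 2 * 1 := (conj_translSL_apply _ 1).1
  by_cases h0 : (σ⁻¹ * τ) 1 0 = 0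
  · exfalso
    apply hab
    have hfix : (Matrix.SpecialLinearGroup.toGL (σ⁻¹ * τ) : GL (Fin 2) ℝ) • (OnePoint.infty : OnePoint ℝ) = OnePoint.infty :=
      OnePoint.smul_infty_eq_self_iff.mpr h0
    rw [map_mul, map_inv, mul_smul, inv_smul_eq_iff, hτ, hσ] at hfix
    exact hfix.symm
  · have hc : ((Matrix.SpecialLinearGroup.toGL (σ⁻¹ * τ * translSL 1 * (σ⁻¹ * τ)⁻¹) : GL (Fin 2) ℝ) 1 0 : ℝ) ≠ 0 := by
      rw [e]; simpa using h0
    have key := one_le_abs_mul_of_mem hΓ' (hd.conj _) one_pos (upperRightHom_one_mem_of_periods hper) hmem hc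
    rw [e, mul_one, mul_one, abs_neg, abs_pow] at key
    nlinarith [abs_nonneg ((σ⁻¹ * τ) 1 0)]

/-- **Disjointness of the horoballs of distinct cusps**: for scaling matrices `σ`, `τ` of cusps
`𝔞 ≠ 𝔟`, `σ {Im > 1} ∩ τ {Im > 1} = ∅` ("for `Y` sufficiently large the cuspidal zones are
disjoint", here with the explicit `Y = 1`). [cite: Iwaniec2002, §2.2 (2.3)–(2.5), PDF pp. 30–31] -/
theorem horoball_disjoint
    (hΓ : Γ ≤ (Matrix.SpecialLinearGroup.toGL : SL(2, ℝ) →* GL (Fin 2) ℝ).range)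
    (hd : IsDiscreteSubgroup Γ)
    (hσ : (Matrix.SpecialLinearGroup.toGL σ : GL (Fin 2) ℝ) • (OnePoint.infty : OnePoint ℝ) = 𝔞)
    (hper : (ConjAct.toConjAct (Matrix.SpecialLinearGroup.toGL σ : GL (Fin 2) ℝ)⁻¹ • Γ).strictPeriods =
      AddSubgroup.zmultiples 1)
    (hτ : (Matrix.SpecialLinearGroup.toGL τ : GL (Fin 2) ℝ) • (OnePoint.infty : OnePoint ℝ) = 𝔟)
    (hperτ : (ConjAct.toConjAct (Matrix.SpecialLinearGroup.toGL τ : GL (Fin 2) ℝ)⁻¹ • Γ).strictPeriods =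
      AddSubgroup.zmultiples 1)
    (hab : 𝔞 ≠ 𝔟) {w w' : ℍ} (hw : 1 < w.im) (hw' : 1 < w'.im) :
    (Matrix.SpecialLinearGroup.toGL σ : GL (Fin 2) ℝ) • w ≠
      (Matrix.SpecialLinearGroup.toGL τ : GL (Fin 2) ℝ) • w' := by
  intro heq
  have hc := one_le_abs_c_of_ne hΓ hd hσ hper hτ hperτ hab
  have key := im_smul_mul_im_le_one (g := Matrix.SpecialLinearGroup.toGL (σ⁻¹ * τ)) ⟨_, rfl⟩ hc w'
  have e : (Matrix.SpecialLinearGroup.toGL (σ⁻¹ * τ) : GL (Fin 2) ℝ) • w' = w := by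
    rw [map_mul, map_inv, mul_smul, ← heq, inv_smul_smul]
  rw [e] at key
  nlinarith

/-- Conjugating `Γ` by one of its own elements does nothing. [folklore] -/
theorem conjAct_smul_eq_self_of_mem {g : GL (Fin 2) ℝ} (hg : g ∈ Γ) : ConjAct.toConjAct g • Γ = Γ := by
  ext δ
  rw [Subgroup.mem_pointwise_smul_iff_inv_smul_mem, ← ConjAct.toConjAct_inv, ConjAct.toConjAct_smul,
    inv_inv]
  constructor
  · intro h
    have := Γ.mul_mem (Γ.mul_mem hg h) (Γ.inv_mem hg)
    simpa [mul_assoc] using this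
  · intro h
    exact Γ.mul_mem (Γ.mul_mem (Γ.inv_mem hg) h) hg

/-- **Moving scaling data by a group element**: if `σ` is a scaling matrix of `𝔞` and `g ∈ Γ`
then `gσ` is a scaling matrix of `g𝔞` (same conjugate group). [cite: Iwaniec2002, §2.2 (2.1), PDF p. 30] -/
theorem scaling_smul
    (hσ : (Matrix.SpecialLinearGroup.toGL σ : GL (Fin 2) ℝ) • (OnePoint.infty : OnePoint ℝ) = 𝔞)
    (hper : (ConjAct.toConjAct (Matrix.SpecialLinearGroup.toGL σ : GL (Fin 2) ℝ)⁻¹ • Γ).strictPeriods =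
      AddSubgroup.zmultiples 1)
    {g : SL(2, ℝ)} (hg : (Matrix.SpecialLinearGroup.toGL g : GL (Fin 2) ℝ) ∈ Γ) :
    (Matrix.SpecialLinearGroup.toGL (g * σ) : GL (Fin 2) ℝ) • (OnePoint.infty : OnePoint ℝ) =
        (Matrix.SpecialLinearGroup.toGL g : GL (Fin 2) ℝ) • 𝔞 ∧
      (ConjAct.toConjAct (Matrix.SpecialLinearGroup.toGL (g * σ) : GL (Fin 2) ℝ)⁻¹ • Γ).strictPeriods =
        AddSubgroup.zmultiples 1 := by
  refine ⟨by rw [map_mul, mul_smul, hσ], ?_⟩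
  have hginv : (Matrix.SpecialLinearGroup.toGL g : GL (Fin 2) ℝ)⁻¹ ∈ Γ := Γ.inv_mem hg
  rw [map_mul, conj_inv_mul, conjAct_smul_eq_self_of_mem hginv]
  exact hper

end Separation

/-! ## 2. The semi-strip `P(Y)` and the area of the cuspidal zones -/

section Strip

/-- The semi-strip `P(Y) = {z = x + iy : 0 ≤ x < 1, y > Y}` ((2.2); half-open in `x` so that its
integer translates partition `{y > Y}`). [cite: Iwaniec2002, §2.2 (2.2), PDF p. 30] -/
def cuspStrip (Y : ℝ) : Set ℍ := {w : ℍ | 0 ≤ w.re ∧ w.re < 1 ∧ Y < w.im}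

/-- Membership in `P(Y)`. [cite: Iwaniec2002, §2.2 (2.2), PDF p. 30] -/
theorem mem_cuspStrip_iff {Y : ℝ} {w : ℍ} : w ∈ cuspStrip Y ↔ 0 ≤ w.re ∧ w.re < 1 ∧ Y < w.im :=
  Iff.rfl

/-- `P(Y)` is measurable. [folklore] -/
theorem measurableSet_cuspStrip (Y : ℝ) : MeasurableSet (cuspStrip Y) := by
  have hre : Measurable fun w : ℍ => w.re := UpperHalfPlane.continuous_re.measurable
  have him : Measurable fun w : ℍ => w.im := UpperHalfPlane.continuous_im.measurable
  refine (measurableSet_le measurable_const hre).inter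
    ((measurableSet_lt hre measurable_const).inter (measurableSet_lt measurable_const him))

/-- An integer translate of `P(Y)` meets `P(Y)` only for the trivial translation. [folklore] -/
theorem int_vadd_mem_cuspStrip {Y : ℝ} {w : ℍ} {n : ℤ} (hw : w ∈ cuspStrip Y)
    (hn : ((n : ℝ) +ᵥ w) ∈ cuspStrip Y) : n = 0 := by
  obtain ⟨h0, h1, -⟩ := hw
  obtain ⟨h0', h1', -⟩ := hn
  rw [UpperHalfPlane.vadd_re] at h0' h1'
  have hlt : (n : ℝ) < 1 := by linarith
  have hgt : (-1 : ℝ) < n := by linarith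
  have h2 : n < 1 := by exact_mod_cast hlt
  have h3 : -1 < n := by exact_mod_cast hgt
  omega

/-- The image of `P(Y)` in `ℂ` is the Euclidean box `[0, 1) × (Y, ∞)` (for `Y ≥ 0`). [folklore] -/
theorem image_coe_cuspStrip {Y : ℝ} (hY : 0 ≤ Y) :
    ((↑) '' cuspStrip Y : Set ℂ) = {z : ℂ | 0 ≤ z.re ∧ z.re < 1 ∧ Y < z.im} := by
  ext z
  constructor
  · rintro ⟨w, ⟨h0, h1, h2⟩, rfl⟩
    exact ⟨h0, h1, h2⟩
  · rintro ⟨h0, h1, h2⟩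
    have hz : 0 < z.im := lt_of_le_of_lt hY h2
    exact ⟨⟨z, hz⟩, ⟨h0, h1, h2⟩, rfl⟩

/-- `∫_Y^∞ y⁻² dy = 1/Y` as a Lebesgue integral (`Y > 0`). [folklore] -/
theorem lintegral_Ioi_inv_sq {Y : ℝ} (hY : 0 < Y) :
    ∫⁻ y in Ioi Y, ENNReal.ofReal ((y ^ 2)⁻¹) = ENNReal.ofReal (1 / Y) := by
  have hint : IntegrableOn (fun y : ℝ => y ^ (-2 : ℝ)) (Ioi Y) :=
    integrableOn_Ioi_rpow_of_lt (by norm_num) hY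
  have hval : ∫ y in Ioi Y, y ^ (-2 : ℝ) = 1 / Y := by
    rw [integral_Ioi_rpow_of_lt (by norm_num) hY]
    have : (-2 : ℝ) + 1 = -1 := by norm_num
    rw [this, Real.rpow_neg_one]
    field_simp
  have e : ∀ y ∈ Ioi Y, ENNReal.ofReal ((y ^ 2)⁻¹) = ENNReal.ofReal (y ^ (-2 : ℝ)) := by
    intro y hy
    have hy0 : 0 < y := hY.trans hy
    congr 1
    rw [Real.rpow_neg hy0.le, Real.rpow_two]
  have hnn : 0 ≤ᵐ[volume.restrict (Ioi Y)] fun y : ℝ => y ^ (-2 : ℝ) :=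
    (ae_restrict_iff' measurableSet_Ioi).mpr
      (Filter.Eventually.of_forall fun y hy => Real.rpow_nonneg (hY.trans hy).le _)
  rw [setLIntegral_congr_fun measurableSet_Ioi e, ← hval, ofReal_integral_eq_lintegral_ofReal hint hnn]

/-- The coercion `ℝ≥0 → ℝ≥0∞` of `(1/‖y‖₊)²` is `ofReal (y²)⁻¹`. [folklore] -/
theorem coe_inv_nnnorm_sq (y : ℝ) (hy : 0 < y) :
    (((1 / ‖y‖₊) ^ 2 : ℝ≥0) : ℝ≥0∞) = ENNReal.ofReal ((y ^ 2)⁻¹) := by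
  rw [ENNReal.ofReal, ENNReal.coe_inj]
  apply NNReal.eq
  rw [Real.coe_toNNReal _ (by positivity)]
  simp [NNReal.coe_pow, Real.nnnorm_of_nonneg hy.le]

/-- **The area of the semi-strip**: `|P(Y)| = ∫_Y^∞ ∫_0^1 y⁻² dx dy = 1/Y` (so the cuspidal zone
`σ_𝔞 P(Y)` has area `1/Y`; with `Y = c_𝔞⁻¹` this is the volume `c_𝔞` of (2.31)).
[cite: Iwaniec2002, §2.2 (2.2) & §2.6 (2.31), PDF pp. 30, 37] -/
theorem volume_cuspStrip {Y : ℝ} (hY : 0 < Y) : volume (cuspStrip Y) = ENNReal.ofReal (1 / Y) := by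
  rw [← setLIntegral_one, setLIntegral_upperHalfPlane (fun _ => 1) measurable_const
    (measurableSet_cuspStrip Y), image_coe_cuspStrip hY.le]
  simp only [one_mul]
  -- to `ℝ × ℝ`
  have hmp := Complex.volume_preserving_equiv_real_prod
  have hme := Complex.measurableEquivRealProd.measurableEmbedding
  have hset : {z : ℂ | 0 ≤ z.re ∧ z.re < 1 ∧ Y < z.im} =
      Complex.measurableEquivRealProd ⁻¹' (Ico (0 : ℝ) 1 ×ˢ Ioi Y) := by
    ext z
    simp [Complex.measurableEquivRealProd_apply, and_assoc]
  set G : ℝ × ℝ → ℝ≥0∞ := fun p => (((1 / ‖p.2‖₊) ^ 2 : ℝ≥0) : ℝ≥0∞) with hG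
  have h1 : ∫⁻ z in Complex.measurableEquivRealProd ⁻¹' (Ico (0 : ℝ) 1 ×ˢ Ioi Y),
      (((1 / ‖z.im‖₊) ^ 2 : ℝ≥0) : ℝ≥0∞) = ∫⁻ p in Ico (0 : ℝ) 1 ×ˢ Ioi Y, G p := by
    have h := hmp.setLIntegral_comp_preimage_emb hme G (Ico (0 : ℝ) 1 ×ˢ Ioi Y)
    simpa [hG, Complex.measurableEquivRealProd_apply] using h
  rw [hset, h1, Measure.volume_eq_prod, ← Measure.prod_restrict]
  have hGm : Measurable fun y : ℝ => (((1 / ‖y‖₊) ^ 2 : ℝ≥0) : ℝ≥0∞) := by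
    refine ENNReal.continuous_coe.measurable.comp ?_
    exact ((measurable_const.div measurable_nnnorm).pow_const 2)
  have e : ∫⁻ p, G p ∂((volume.restrict (Ico (0 : ℝ) 1)).prod (volume.restrict (Ioi Y))) =
      (∫⁻ _x in Ico (0 : ℝ) 1, (1 : ℝ≥0∞)) * ∫⁻ y in Ioi Y, (((1 / ‖y‖₊) ^ 2 : ℝ≥0) : ℝ≥0∞) := by
    rw [← lintegral_prod_mul aemeasurable_const hGm.aemeasurable]
    simp [hG]
  rw [e, setLIntegral_one, Real.volume_Ico, sub_zero, ENNReal.ofReal_one, one_mul]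
  rw [setLIntegral_congr_fun measurableSet_Ioi (fun y hy => coe_inv_nnnorm_sq y (hY.trans hy))]
  exact lintegral_Ioi_inv_sq hY

/-- The cuspidal zones `g P(Y)` have the same area `1/Y` (invariance of `μ`).
[cite: Iwaniec2002, §2.2 (2.3), PDF p. 30] -/
theorem volume_smul_cuspStrip (g : GL (Fin 2) ℝ) {Y : ℝ} (hY : 0 < Y) :
    volume (g • cuspStrip Y) = ENNReal.ofReal (1 / Y) := by
  rw [measure_smul, volume_cuspStrip hY]

/-- The cuspidal zones are measurable. [folklore] -/
theorem measurableSet_smul_cuspStrip (g : GL (Fin 2) ℝ) (Y : ℝ) : MeasurableSet (g • cuspStrip Y) := by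
  rw [← preimage_smul_inv]
  exact measurableSet_cuspStrip Y |>.preimage (measurable_const_smul g⁻¹)

end Strip

/-! ## 3. Cuspidal zones of inequivalent cusps inject into `Γ\ℍ` -/

section Zones

variable {m : ℕ} {𝔞 : Fin m → OnePoint ℝ} {σ : Fin m → SL(2, ℝ)}

/-- The union of the cuspidal zones `σ_i P(Y)` of a family of scaling matrices ((2.3), (2.5)).
[cite: Iwaniec2002, §2.2 (2.3)–(2.5), PDF pp. 30–31] -/
def cuspZones (σ : Fin m → SL(2, ℝ)) (Y : ℝ) : Set ℍ :=
  ⋃ i, (Matrix.SpecialLinearGroup.toGL (σ i) : GL (Fin 2) ℝ) • cuspStrip Y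

/-- Membership in the union of cuspidal zones. [cite: Iwaniec2002, §2.2 (2.3), PDF p. 30] -/
theorem mem_cuspZones_iff {Y : ℝ} {z : ℍ} : z ∈ cuspZones σ Y ↔
    ∃ i, ∃ u ∈ cuspStrip Y, (Matrix.SpecialLinearGroup.toGL (σ i) : GL (Fin 2) ℝ) • u = z := by
  simp only [cuspZones, mem_iUnion, mem_smul_set]

/-- The union of cuspidal zones is measurable. [folklore] -/
theorem measurableSet_cuspZones (σ : Fin m → SL(2, ℝ)) (Y : ℝ) : MeasurableSet (cuspZones σ Y) :=
  MeasurableSet.iUnion fun _ => measurableSet_smul_cuspStrip _ Y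

/-- Pairwise inequivalent cusps are pairwise distinct. [folklore] -/
theorem ne_of_inequivalent (hineq : ∀ i j, ∀ γ ∈ Γ, γ • 𝔞 i = 𝔞 j → i = j) {i j : Fin m}
    (hij : i ≠ j) : 𝔞 i ≠ 𝔞 j := fun h =>
  hij (hineq i j 1 Γ.one_mem (by rw [one_smul, h]))

/-- Integral translations act on `ℍ` by `z ↦ z + n`, through `GL₂(ℝ)`. [folklore] -/
theorem upperRightHom_smul (x : ℝ) (w : ℍ) :
    (Matrix.GeneralLinearGroup.upperRightHom x : GL (Fin 2) ℝ) • w = x +ᵥ w := by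
  rw [← toGL_translSL]
  apply UpperHalfPlane.ext
  change ((translSL x • w : ℍ) : ℂ) = ((x +ᵥ w : ℍ) : ℂ)
  rw [coe_vadd, coe_specialLinearGroup_apply]
  simp [add_comm]

/-- **For `η ∈ Γ_𝔞`, `σ⁻¹ησ` is `±` an integral translation** (`σ⁻¹Γ_𝔞σ = B`, (2.1)), for scaling
data with periods `ℤ`. [cite: Iwaniec2002, §2.2 (2.1) & §2.4 (2.15), PDF pp. 30, 34] -/
theorem conj_eq_upperRightHom_of_smul_eq
    (hΓ : Γ ≤ (Matrix.SpecialLinearGroup.toGL : SL(2, ℝ) →* GL (Fin 2) ℝ).range)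
    (hneg : -1 ∈ Γ) (hd : IsDiscreteSubgroup Γ) {a : OnePoint ℝ} {s : SL(2, ℝ)}
    (hs : (Matrix.SpecialLinearGroup.toGL s : GL (Fin 2) ℝ) • (OnePoint.infty : OnePoint ℝ) = a)
    (hper : (ConjAct.toConjAct (Matrix.SpecialLinearGroup.toGL s : GL (Fin 2) ℝ)⁻¹ • Γ).strictPeriods =
      AddSubgroup.zmultiples 1)
    {η : GL (Fin 2) ℝ} (hη : η ∈ Γ) (hfix : η • a = a) : ∃ n : ℤ,
      (Matrix.SpecialLinearGroup.toGL s : GL (Fin 2) ℝ)⁻¹ * η * Matrix.SpecialLinearGroup.toGL s =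
          Matrix.GeneralLinearGroup.upperRightHom (n : ℝ) ∨
        (Matrix.SpecialLinearGroup.toGL s : GL (Fin 2) ℝ)⁻¹ * η * Matrix.SpecialLinearGroup.toGL s =
          -Matrix.GeneralLinearGroup.upperRightHom (n : ℝ) := by
  set Γ' := ConjAct.toConjAct (Matrix.SpecialLinearGroup.toGL s : GL (Fin 2) ℝ)⁻¹ • Γ with hΓ'
  have hΓ'le : Γ' ≤ (Matrix.SpecialLinearGroup.toGL : SL(2, ℝ) →* GL (Fin 2) ℝ).range := by
    have h := conj_le_range hΓ s⁻¹
    rwa [map_inv] at h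
  have hd' : IsDiscreteSubgroup Γ' := hd.conj _
  have hneg' : -1 ∈ Γ' := (neg_one_mem_conj_iff _).mpr hneg
  have hinf : IsCusp OnePoint.infty Γ' := isCusp_infty_of_mem (upperRightHom_one_mem_of_periods hper)
  have hw : Γ'.strictWidthInfty = 1 := strictWidthInfty_eq_one_of_periods hd hper
  have hmem : (Matrix.SpecialLinearGroup.toGL s : GL (Fin 2) ℝ)⁻¹ * η * Matrix.SpecialLinearGroup.toGL s ∈ Γ' :=
    conj_mem_conj_inv hη _
  have hc : (((Matrix.SpecialLinearGroup.toGL s : GL (Fin 2) ℝ)⁻¹ * η *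
      Matrix.SpecialLinearGroup.toGL s : GL (Fin 2) ℝ) 1 0 : ℝ) = 0 := (conj_c_eq_zero_iff hs η).mpr hfix
  obtain ⟨n, hn⟩ := (mem_and_apply_10_eq_zero_iff hΓ'le hneg' hd' hinf _).mp ⟨hmem, hc⟩
  rw [hw, mul_one] at hn
  exact ⟨n, hn⟩

/-- **Injectivity of the cuspidal zones** (the zones `σ_𝔞 P(Y)`, `Y ≥ 1`, of inequivalent cusps
are disjoint and each meets its `Γ`-translates only through `Γ_𝔞`, which acts on `σ_𝔞 P(Y)` by
the integer translations): if `γ, δ ∈ Γ` both move `w` into `⋃_i σ_i P(Y)` then `δ = ±γ`.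
[cite: Iwaniec2002, §2.2 (2.3)–(2.5), PDF pp. 30–31] -/
theorem eq_or_eq_neg_of_smul_mem_zones
    (hΓ : Γ ≤ (Matrix.SpecialLinearGroup.toGL : SL(2, ℝ) →* GL (Fin 2) ℝ).range)
    (hneg : -1 ∈ Γ) (hd : IsDiscreteSubgroup Γ)
    (hinfty : ∀ i, (Matrix.SpecialLinearGroup.toGL (σ i) : GL (Fin 2) ℝ) • (OnePoint.infty : OnePoint ℝ) = 𝔞 i)
    (hper : ∀ i, (ConjAct.toConjAct (Matrix.SpecialLinearGroup.toGL (σ i) : GL (Fin 2) ℝ)⁻¹ • Γ).strictPeriods =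
      AddSubgroup.zmultiples 1)
    (hineq : ∀ i j, ∀ γ ∈ Γ, γ • 𝔞 i = 𝔞 j → i = j) {Y : ℝ} (hY : 1 ≤ Y) {w : ℍ}
    {γ δ : GL (Fin 2) ℝ} (hγ : γ ∈ Γ) (hδ : δ ∈ Γ) (hγw : γ • w ∈ cuspZones σ Y)
    (hδw : δ • w ∈ cuspZones σ Y) : δ = γ ∨ δ = -γ := by
  obtain ⟨i, u, hu, eu⟩ := mem_cuspZones_iff.mp hγw
  obtain ⟨j, u', hu', eu'⟩ := mem_cuspZones_iff.mp hδw
  set η : GL (Fin 2) ℝ := δ * γ⁻¹ with hη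
  have hηmem : η ∈ Γ := Γ.mul_mem hδ (Γ.inv_mem hγ)
  obtain ⟨g, hg⟩ := hΓ hηmem
  have hgmem : (Matrix.SpecialLinearGroup.toGL g : GL (Fin 2) ℝ) ∈ Γ := hg ▸ hηmem
  -- `η` maps the point `σ_i u` of the `i`-th zone to the point `σ_j u'` of the `j`-th zone
  have hmove : η • ((Matrix.SpecialLinearGroup.toGL (σ i) : GL (Fin 2) ℝ) • u) =
      (Matrix.SpecialLinearGroup.toGL (σ j) : GL (Fin 2) ℝ) • u' := by
    rw [eu, eu', hη, mul_smul, inv_smul_smul]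
  have hu1 : 1 < u.im := lt_of_le_of_lt hY hu.2.2
  have hu1' : 1 < u'.im := lt_of_le_of_lt hY hu'.2.2
  -- hence `η 𝔞_i = 𝔞_j` (horoball separation), so `i = j` and `η ∈ Γ_{𝔞_i}`
  have hfix : η • 𝔞 i = 𝔞 j := by
    by_contra hne
    obtain ⟨hs1, hs2⟩ := scaling_smul (hinfty i) (hper i) hgmem
    rw [hg] at hs1
    have h := horoball_disjoint hΓ hd hs1 hs2 (hinfty j) (hper j) hne hu1 hu1'
    apply h
    rw [map_mul, hg, mul_smul]
    exact hmove
  have hij : i = j := hineq i j η hηmem hfix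
  subst hij
  obtain ⟨n, hn⟩ := conj_eq_upperRightHom_of_smul_eq hΓ hneg hd (hinfty i) (hper i) hηmem hfix
  -- `σ⁻¹ησ = ±(1 n; 0 1)` maps `u ∈ P(Y)` to `u' ∈ P(Y)`, so `n = 0`
  have hmove' : ((Matrix.SpecialLinearGroup.toGL (σ i) : GL (Fin 2) ℝ)⁻¹ * η *
      Matrix.SpecialLinearGroup.toGL (σ i)) • u = u' := by
    rw [mul_smul, mul_smul, hmove, inv_smul_smul]
  have hvadd : ((n : ℝ) +ᵥ u) = u' := by
    rcases hn with hn | hn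
    · rw [hn, upperRightHom_smul] at hmove'
      exact hmove'
    · rw [hn, UpperHalfPlane.neg_smul, upperRightHom_smul] at hmove'
      exact hmove'
  have hn0 : n = 0 := int_vadd_mem_cuspStrip hu (hvadd ▸ hu')
  subst hn0
  rw [Int.cast_zero, AddChar.map_zero_eq_one] at hn
  -- so `η = ±1`
  have eη : η = (Matrix.SpecialLinearGroup.toGL (σ i) : GL (Fin 2) ℝ) *
      (((Matrix.SpecialLinearGroup.toGL (σ i) : GL (Fin 2) ℝ)⁻¹ * η *
        Matrix.SpecialLinearGroup.toGL (σ i))) * (Matrix.SpecialLinearGroup.toGL (σ i) : GL (Fin 2) ℝ)⁻¹ := by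
    group
  have hδ' : δ = η * γ := by rw [hη]; group
  rcases hn with hn | hn
  · left
    rw [hδ', eη, hn]
    group
  · right
    rw [hδ', eη, hn]
    simp

/-- Consequently `Σ_{γ ∈ Γ} 𝟙_{⋃ σ_i P(Y)}(γ w) ≤ 2` for every `w`. [cite: Iwaniec2002, §2.2 (2.3)–(2.5), PDF pp. 30–31] -/
theorem tsum_indicator_cuspZones_le_two
    (hΓ : Γ ≤ (Matrix.SpecialLinearGroup.toGL : SL(2, ℝ) →* GL (Fin 2) ℝ).range)
    (hneg : -1 ∈ Γ) (hd : IsDiscreteSubgroup Γ)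
    (hinfty : ∀ i, (Matrix.SpecialLinearGroup.toGL (σ i) : GL (Fin 2) ℝ) • (OnePoint.infty : OnePoint ℝ) = 𝔞 i)
    (hper : ∀ i, (ConjAct.toConjAct (Matrix.SpecialLinearGroup.toGL (σ i) : GL (Fin 2) ℝ)⁻¹ • Γ).strictPeriods =
      AddSubgroup.zmultiples 1)
    (hineq : ∀ i j, ∀ γ ∈ Γ, γ • 𝔞 i = 𝔞 j → i = j) {Y : ℝ} (hY : 1 ≤ Y) (w : ℍ) :
    (∑' γ : Γ, (cuspZones σ Y).indicator (fun _ => (1 : ℝ≥0∞)) ((γ : GL (Fin 2) ℝ) • w)) ≤ 2 := by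
  classical
  by_cases h : ∃ γ : Γ, (γ : GL (Fin 2) ℝ) • w ∈ cuspZones σ Y
  · obtain ⟨γ₀, hγ₀⟩ := h
    have hnegmem : -(γ₀ : GL (Fin 2) ℝ) ∈ Γ := by
      rw [← neg_one_mul]; exact Γ.mul_mem hneg γ₀.2
    set S : Finset Γ := {γ₀, ⟨-(γ₀ : GL (Fin 2) ℝ), hnegmem⟩} with hS
    have hzero : ∀ γ : Γ, γ ∉ S →
        (cuspZones σ Y).indicator (fun _ => (1 : ℝ≥0∞)) ((γ : GL (Fin 2) ℝ) • w) = 0 := by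
      intro γ hγS
      rw [indicator_apply_eq_zero]
      intro hmem
      exfalso
      apply hγS
      rcases eq_or_eq_neg_of_smul_mem_zones hΓ hneg hd hinfty hper hineq hY γ₀.2 γ.2 hγ₀ hmem with h1 | h1
      · rw [hS, Finset.mem_insert]
        left
        exact Subtype.ext h1
      · rw [hS, Finset.mem_insert, Finset.mem_singleton]
        right
        exact Subtype.ext h1
    rw [tsum_eq_sum hzero]
    calc ∑ γ ∈ S, (cuspZones σ Y).indicator (fun _ => (1 : ℝ≥0∞)) ((γ : GL (Fin 2) ℝ) • w)
        ≤ ∑ _γ ∈ S, (1 : ℝ≥0∞) :=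
          Finset.sum_le_sum fun γ _ => indicator_le_self' (fun _ _ => zero_le_one) _
      _ = S.card := by simp
      _ ≤ 2 := by
          have : S.card ≤ 2 := Finset.card_le_two
          exact_mod_cast this
  · push Not at h
    have : ∀ γ : Γ, (cuspZones σ Y).indicator (fun _ => (1 : ℝ≥0∞)) ((γ : GL (Fin 2) ℝ) • w) = 0 :=
      fun γ => indicator_of_notMem (h γ) _
    simp [this]

/-! ## 4. The number of inequivalent cusps is at most `|F|` -/

/-- The cuspidal zones of inequivalent cusps have total area at most `|F|` (unfolding against the
fundamental domain: `2 |⋃ σ_i P(Y)| = ∫_F Σ_γ 𝟙(γw) dμ ≤ 2|F|`).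
[cite: Iwaniec2002, §2.2 & §2.6 (2.31), PDF pp. 28–31, 37] -/
theorem volume_cuspZones_le
    (hΓ : Γ ≤ (Matrix.SpecialLinearGroup.toGL : SL(2, ℝ) →* GL (Fin 2) ℝ).range)
    (hneg : -1 ∈ Γ) (hd : IsDiscreteSubgroup Γ) (hF : IsHypFundamentalDomain Γ F)
    (hinfty : ∀ i, (Matrix.SpecialLinearGroup.toGL (σ i) : GL (Fin 2) ℝ) • (OnePoint.infty : OnePoint ℝ) = 𝔞 i)
    (hper : ∀ i, (ConjAct.toConjAct (Matrix.SpecialLinearGroup.toGL (σ i) : GL (Fin 2) ℝ)⁻¹ • Γ).strictPeriods =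
      AddSubgroup.zmultiples 1)
    (hineq : ∀ i j, ∀ γ ∈ Γ, γ • 𝔞 i = 𝔞 j → i = j) {Y : ℝ} (hY : 1 ≤ Y) :
    volume (cuspZones σ Y) ≤ volume F := by
  set φ : ℍ → ℝ≥0∞ := (cuspZones σ Y).indicator fun _ => 1 with hφ
  have hφm : AEMeasurable φ := ((measurable_const.indicator (measurableSet_cuspZones σ Y))).aemeasurable
  have key := setLIntegral_tsum_smul_eq hΓ hneg hd.countable hF hφm
  have hint : ∫⁻ w, φ w = volume (cuspZones σ Y) := by
    rw [hφ]
    exact lintegral_indicator_one (measurableSet_cuspZones σ Y)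
  rw [hint] at key
  have hle : ∫⁻ w in F, ∑' γ : Γ, φ ((γ : GL (Fin 2) ℝ) • w) ≤ 2 * volume F := by
    calc ∫⁻ w in F, ∑' γ : Γ, φ ((γ : GL (Fin 2) ℝ) • w) ≤ ∫⁻ _w in F, (2 : ℝ≥0∞) :=
          lintegral_mono fun w => tsum_indicator_cuspZones_le_two hΓ hneg hd hinfty hper hineq hY w
      _ = 2 * volume F := by rw [setLIntegral_const, mul_comm]
  rw [key] at hle
  exact (ENNReal.mul_le_mul_iff_right two_ne_zero ENNReal.ofNat_ne_top).mp hle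

/-- The cuspidal zones of inequivalent cusps are disjoint, of total area `m/Y`.
[cite: Iwaniec2002, §2.2 (2.3)–(2.5), PDF pp. 30–31] -/
theorem volume_cuspZones_eq
    (hΓ : Γ ≤ (Matrix.SpecialLinearGroup.toGL : SL(2, ℝ) →* GL (Fin 2) ℝ).range)
    (hd : IsDiscreteSubgroup Γ)
    (hinfty : ∀ i, (Matrix.SpecialLinearGroup.toGL (σ i) : GL (Fin 2) ℝ) • (OnePoint.infty : OnePoint ℝ) = 𝔞 i)
    (hper : ∀ i, (ConjAct.toConjAct (Matrix.SpecialLinearGroup.toGL (σ i) : GL (Fin 2) ℝ)⁻¹ • Γ).strictPeriods =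
      AddSubgroup.zmultiples 1)
    (hineq : ∀ i j, ∀ γ ∈ Γ, γ • 𝔞 i = 𝔞 j → i = j) {Y : ℝ} (hY : 1 ≤ Y) :
    volume (cuspZones σ Y) = m * ENNReal.ofReal (1 / Y) := by
  have hY0 : 0 < Y := lt_of_lt_of_le one_pos hY
  have hdisj : Pairwise fun i j => Disjoint
      ((Matrix.SpecialLinearGroup.toGL (σ i) : GL (Fin 2) ℝ) • cuspStrip Y)
      ((Matrix.SpecialLinearGroup.toGL (σ j) : GL (Fin 2) ℝ) • cuspStrip Y) := by
    intro i j hij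
    rw [Set.disjoint_left]
    rintro z ⟨u, hu, rfl⟩ ⟨u', hu', e'⟩
    exact horoball_disjoint hΓ hd (hinfty i) (hper i) (hinfty j) (hper j) (ne_of_inequivalent hineq hij)
      (lt_of_le_of_lt hY hu.2.2) (lt_of_le_of_lt hY hu'.2.2) e'.symm
  rw [cuspZones, measure_iUnion hdisj fun i => measurableSet_smul_cuspStrip _ Y]
  simp only [volume_smul_cuspStrip _ hY0, tsum_fintype, Finset.sum_const, Finset.card_univ,
    Fintype.card_fin, nsmul_eq_mul]

/-- **The number of inequivalent cusps is at most the covolume**: if `𝔞_0, …, 𝔞_{m-1}` are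
pairwise inequivalent cusps of a discrete `Γ ≤ SL₂(ℝ)` (`-1 ∈ Γ`), with scaling matrices, and `F`
is a measurable fundamental domain, then `m ≤ |F|` (each cusp contributes the disjoint, embedded
cuspidal zone `σ_𝔞 P(1)` of area `1`; in the book `c_𝔞 < |F|`, (2.31), and the finiteness of the
cusps of a finite volume group, Prop. 2.3–2.4). [cite: Iwaniec2002, Prop. 2.3–2.4 & §2.6 (2.31), PDF pp. 28–29, 37] -/
theorem card_le_volume_of_inequivalent_cusps
    (hΓ : Γ ≤ (Matrix.SpecialLinearGroup.toGL : SL(2, ℝ) →* GL (Fin 2) ℝ).range)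
    (hneg : -1 ∈ Γ) (hd : IsDiscreteSubgroup Γ) (hF : IsHypFundamentalDomain Γ F)
    (hinfty : ∀ i, (Matrix.SpecialLinearGroup.toGL (σ i) : GL (Fin 2) ℝ) • (OnePoint.infty : OnePoint ℝ) = 𝔞 i)
    (hper : ∀ i, (ConjAct.toConjAct (Matrix.SpecialLinearGroup.toGL (σ i) : GL (Fin 2) ℝ)⁻¹ • Γ).strictPeriods =
      AddSubgroup.zmultiples 1)
    (hineq : ∀ i j, ∀ γ ∈ Γ, γ • 𝔞 i = 𝔞 j → i = j) :
    (m : ℝ≥0∞) ≤ volume F := by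
  have h1 := volume_cuspZones_le hΓ hneg hd hF hinfty hper hineq (Y := 1) le_rfl
  rwa [volume_cuspZones_eq hΓ hd hinfty hper hineq le_rfl, div_one, ENNReal.ofReal_one, mul_one] at h1

end Zones

/-! ## 5. Finitely many cusp orbits; a complete system of inequivalent cusps -/

section Orbits

/-- Representatives of distinct cusp orbits are inequivalent, in the form used above. [folklore] -/
theorem inequivalent_of_injective_orbit {m : ℕ} (c : Fin m → cuspsSubMulAction Γ)
    (hinj : Function.Injective fun i => (Quotient.mk (MulAction.orbitRel Γ (cuspsSubMulAction Γ)) (c i) :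
      CuspOrbits Γ)) :
    ∀ i j, ∀ γ ∈ Γ, γ • (c i : OnePoint ℝ) = (c j : OnePoint ℝ) → i = j := by
  intro i j γ hγ h
  apply hinj
  apply Quotient.sound
  -- `c j = γ • c i`, so `c i ∈ orbit (c j)` via `γ⁻¹`
  change c i ∈ MulAction.orbit Γ (c j)
  rw [MulAction.mem_orbit_iff]
  refine ⟨⟨γ⁻¹, Γ.inv_mem hγ⟩, ?_⟩
  apply Subtype.ext
  rw [SubMulAction.val_smul, Subgroup.mk_smul, ← h, inv_smul_smul]

/-- **A finite volume group has finitely many cusp orbits** (Prop. 2.3–2.4: a finite volume group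
has a fundamental polygon with finitely many, inequivalent, cuspidal vertices).
[cite: Iwaniec2002, Prop. 2.3–2.4, PDF pp. 28–29] -/
theorem finite_cuspOrbits
    (hΓ : Γ ≤ (Matrix.SpecialLinearGroup.toGL : SL(2, ℝ) →* GL (Fin 2) ℝ).range)
    (hneg : -1 ∈ Γ) (hd : IsDiscreteSubgroup Γ) (hF : IsHypFundamentalDomain Γ F)
    (hvol : volume F < ⊤) : Finite (CuspOrbits Γ) := by
  classical
  by_contra hinf
  rw [not_finite_iff_infinite] at hinf
  set N : ℕ := ⌊(volume F).toReal⌋₊ + 1 with hN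
  obtain ⟨s, hs⟩ := Infinite.exists_subset_card_eq (CuspOrbits Γ) N
  -- representatives of the `N` orbits in `s`
  set q : Fin N → CuspOrbits Γ := fun i => (s.equivFin.symm (Fin.cast hs.symm i) : CuspOrbits Γ) with hq
  have hqinj : Function.Injective q := by
    intro i j hij
    have h1 := Subtype.ext hij
    have h2 := s.equivFin.symm.injective h1
    exact Fin.cast_injective _ h2
  set c : Fin N → cuspsSubMulAction Γ := fun i => (q i).out with hc
  have hcq : ∀ i, (Quotient.mk (MulAction.orbitRel Γ (cuspsSubMulAction Γ)) (c i) : CuspOrbits Γ) = q i :=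
    fun i => Quotient.out_eq (q i)
  have hinj : Function.Injective fun i =>
      (Quotient.mk (MulAction.orbitRel Γ (cuspsSubMulAction Γ)) (c i) : CuspOrbits Γ) := by
    intro i j hij
    simp only [hcq] at hij
    exact hqinj hij
  have hineq := inequivalent_of_injective_orbit c hinj
  -- scaling matrices
  have hcusp : ∀ i, IsCusp (c i : OnePoint ℝ) Γ := fun i => (c i).2
  choose σ hσ using fun i => exists_scaling hΓ hd (hcusp i)
  have hle := card_le_volume_of_inequivalent_cusps (𝔞 := fun i => (c i : OnePoint ℝ)) hΓ hneg hd hF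
    (fun i => (hσ i).1) (fun i => (hσ i).2.1) hineq
  -- `N ≤ |F| < N`
  have hle' : (N : ℝ) ≤ (volume F).toReal := by
    have := ENNReal.toReal_mono hvol.ne hle
    simpa using this
  have hlt : (volume F).toReal < N := by
    rw [hN]
    push_cast
    exact Nat.lt_floor_add_one _
  linarith

/-- **A complete system of inequivalent cusps with scaling matrices** for a finite volume group:
cusps `𝔞_0, …, 𝔞_{h-1}`, `h ≤ |F|`, pairwise inequivalent, with scaling matrices `σ_i` (`σ_i ∞ = 𝔞_i`,
periods of `σ_i⁻¹Γσ_i` equal to `ℤ`, so `(1 1; 0 1) ∈ σ_i⁻¹Γσ_i` and `σ_i⁻¹Γ_{𝔞_i}σ_i = B`), such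
that every cusp of `Γ` is equivalent to one of them — the standing data "`𝔞` runs over inequivalent
cusps, `σ_𝔞` is a scaling matrix of `𝔞`" of Chapters 2–8 (Prop. 2.4 and (2.1)).
[cite: Iwaniec2002, Prop. 2.4 & §2.2 (2.1), PDF pp. 28–30] -/
theorem exists_cuspSystem
    (hΓ : Γ ≤ (Matrix.SpecialLinearGroup.toGL : SL(2, ℝ) →* GL (Fin 2) ℝ).range)
    (hneg : -1 ∈ Γ) (hd : IsDiscreteSubgroup Γ) (hF : IsHypFundamentalDomain Γ F)
    (hvol : volume F < ⊤) :
    ∃ (h : ℕ) (𝔞 : Fin h → OnePoint ℝ) (σ : Fin h → SL(2, ℝ)),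
      (h : ℝ≥0∞) ≤ volume F ∧
      (∀ i, (Matrix.SpecialLinearGroup.toGL (σ i) : GL (Fin 2) ℝ) • (OnePoint.infty : OnePoint ℝ) = 𝔞 i) ∧
      (∀ i, (ConjAct.toConjAct (Matrix.SpecialLinearGroup.toGL (σ i) : GL (Fin 2) ℝ)⁻¹ • Γ).strictPeriods =
        AddSubgroup.zmultiples 1) ∧
      (∀ i j, ∀ γ ∈ Γ, γ • 𝔞 i = 𝔞 j → i = j) ∧
      ∀ c : OnePoint ℝ, IsCusp c Γ → ∃ i, ∃ γ ∈ Γ, γ • 𝔞 i = c := by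
  classical
  haveI : Finite (CuspOrbits Γ) := finite_cuspOrbits hΓ hneg hd hF hvol
  haveI : Fintype (CuspOrbits Γ) := Fintype.ofFinite _
  set h : ℕ := Fintype.card (CuspOrbits Γ) with hh
  set e : CuspOrbits Γ ≃ Fin h := Fintype.equivFin (CuspOrbits Γ) with he
  set c : Fin h → cuspsSubMulAction Γ := fun i => (e.symm i).out with hc
  have hcq : ∀ i, (Quotient.mk (MulAction.orbitRel Γ (cuspsSubMulAction Γ)) (c i) : CuspOrbits Γ) = e.symm i :=
    fun i => Quotient.out_eq (e.symm i)
  have hinj : Function.Injective fun i =>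
      (Quotient.mk (MulAction.orbitRel Γ (cuspsSubMulAction Γ)) (c i) : CuspOrbits Γ) := by
    intro i j hij
    simp only [hcq] at hij
    exact e.symm.injective hij
  have hineq := inequivalent_of_injective_orbit c hinj
  have hcusp : ∀ i, IsCusp (c i : OnePoint ℝ) Γ := fun i => (c i).2
  choose σ hσ using fun i => exists_scaling hΓ hd (hcusp i)
  refine ⟨h, fun i => (c i : OnePoint ℝ), σ, ?_, fun i => (hσ i).1, fun i => (hσ i).2.1, hineq, ?_⟩
  · exact card_le_volume_of_inequivalent_cusps hΓ hneg hd hF (fun i => (hσ i).1) (fun i => (hσ i).2.1) hineq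
  · intro a ha
    set x : cuspsSubMulAction Γ := ⟨a, ha⟩ with hx
    set i : Fin h := e (Quotient.mk (MulAction.orbitRel Γ (cuspsSubMulAction Γ)) x) with hi
    refine ⟨i, ?_⟩
    have hrel : (MulAction.orbitRel Γ (cuspsSubMulAction Γ)) (c i) x := by
      apply Quotient.exact
      rw [hcq i, hi, Equiv.symm_apply_apply]
    rw [MulAction.orbitRel_apply, MulAction.mem_orbit_iff] at hrel
    obtain ⟨g, hg⟩ := hrel
    refine ⟨((g⁻¹ : Γ) : GL (Fin 2) ℝ), (g⁻¹).2, ?_⟩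
    have e1 : (((g⁻¹ : Γ) • c i : cuspsSubMulAction Γ) : OnePoint ℝ) = (x : OnePoint ℝ) := by
      rw [← hg, inv_smul_smul]
    rw [SubMulAction.val_smul] at e1
    exact e1

end Orbits

end Fuchsian

end Literature.NumberTheory.Automorphic

end
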